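import Summits.RiemannHypothesis.RiemannHypothesis.Theorems.LiDirichletAsymptoticCharWindow
import Summits.RiemannHypothesis.RiemannHypothesis.Theorems.LiCoefficientsLiWindowTuring
import Summits.RiemannHypothesis.RiemannHypothesis.Theorems.LiAsymptoticSmoothReplace
import HarnessLib

/-!
# RiemannHypothesis / LiDirichletAsymptotic — crux K3χ `LiOscillatoryChar`, stub `stub_osc_plain`:
# the OSCILLATORY term against the tree's counting remainder (RH-FREE · GRH-FREE)

RH-FREE · GRH-FREE PROOF-OF-DATA (rung L-P(P1⁺χ)) [rh-li-prover].  Route `Theses/LiDirichletAsymptotic.lean`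
(cell `pub/rh-li`, round 5 (iii)), item `LiOscillatoryChar` (stmt-RiemannHypothesis-19628, deciding), registered birth
stub `stub_osc_plain` VERBATIM (`bc/LiOscillatoryChar_birth.lean`): for `χ` primitive mod `q > 1`, `n ≥ 10⁴`, `T' ≥ n²`,

  `|(charWeightTrace χ n T' − charWeightTrace χ n √n) − (2/π)∫_{√n}^{T'} f_n g_χ|
      ≤ charErrOscP q n + (n²/(2T'²))·argSRem q T'`,

`f_n = liWindowWeight n`, `g_χ = charGammaDensity χ`.  Proof: the window sum is `∑_{√n<|γ|≤T'} m f_n(|γ|)` (for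
`|γ| > 0` the completed weight `liWindowWeight₀` IS `f_n`); by the remainder identity of `CharWindow`
(`CharCount.abs_finsum_window_sub_integral_le`: partial summation against `N(t,χ) = charCountMainExact χ t + R(t)`,
`d/dt charCountMainExact = (2/π) g_χ`) it differs from `∫ f_n (2/π) g_χ` by at most
`|R(T')| f_n(T') + |R(√n)| f_n(√n) + ∫_{√n}^{T'} |R| |f_n'|`, with `|R(t)| ≤ argSRem q t + 0.014` at EVERY height
(`CharCount.abs_count_sub_exact_le_argSRem`), `0 ≤ f_n ≤ 2`, `f_n(T') ≤ n²/(2T'²)` (`SmoothReplace.liWindowWeight_mem/_le_sq`),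
`|f_n'| ≤ n/t²` (`Window.abs_liWindowWeightDeriv_le`), and the remainder integral
`∫_a^b (A_q + 12.975 log(t+4)) n/t² dt ≤ n (A_q + 12.975 (log(a+4) + 1))/a` (`A_q = 5.014 + 12.975 log(9.1902 q)`; the
majorant is dominated by the derivative of `−n(A_q + 12.975(log(t+4)+1))/t`).  Numerics: `log 9.1902 ≤ 2.2194`, so
`5.014 + 12.975·2.2194 + 12.975 ≤ 46.8` — the TYPED constant of `charErrOscP`, used verbatim.
Nothing here bears on the truth of RH or GRH.
-/

noncomputable section

-- D-0017: `Summit.<S>.<S>.…` is the designed namespace of a single-problem summit.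
set_option linter.dupNamespace false

open MeasureTheory intervalIntegral Set Filter
open scoped Topology

namespace Summit.RiemannHypothesis.RiemannHypothesis.Theorems.LiTheory

open Literature.NumberTheory.LFunctions Literature.NumberTheory.LFunctions.ExplicitPsiChar
open Literature.NumberTheory.LFunctions.DirichletTheta
open Literature.NumberTheory.LFunctions.DirichletDisc (zeroOrder)

namespace OscChar

variable {q : ℕ} [NeZero q] {χ : DirichletCharacter ℂ q}

/-! ### Numerics and sizes -/

/-- `log 9.1902 ≤ 2.2194` (`9.1902 ≤ 2³ · 1.01749⁸`, `log x ≤ x − 1`). -/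
theorem log_91902_le : Real.log 9.1902 ≤ 2.2194 := by
  have h1 : (9.1902 : ℝ) ≤ 2 ^ 3 * 1.01749 ^ 8 := by norm_num
  have h2 := Real.log_two_lt_d9
  have h3 := Real.log_le_sub_one_of_pos (show (0 : ℝ) < 1.01749 by norm_num)
  calc Real.log 9.1902 ≤ Real.log (2 ^ 3 * 1.01749 ^ 8) := Real.log_le_log (by norm_num) h1
    _ = 3 * Real.log 2 + 8 * Real.log 1.01749 := by
        rw [Real.log_mul (by norm_num) (by norm_num), Real.log_pow, Real.log_pow]; norm_num
    _ ≤ 2.2194 := by linarith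

omit [NeZero q] in
/-- `argSRem q t + 0.014 = A_q + 12.975 log(t + 4)` with `A_q = 5.014 + 12.975 log(9.1902 q)` (`t > 0`). -/
theorem argSRem_add_eq (hq : 1 < q) {t : ℝ} (ht : 0 < t) :
    argSRem q t + 0.014 = 5.014 + 12.975 * Real.log (9.1902 * q) + 12.975 * Real.log (t + 4) := by
  have hq0 : (0 : ℝ) < q := by exact_mod_cast lt_trans zero_lt_one hq
  unfold argSRem
  rw [Real.log_mul (by positivity) (by linarith)]
  ring

/-! ### The remainder integral -/

/-- **The remainder integral**: for `χ` primitive mod `q > 1`, `0 < a ≤ b`,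
`∫_a^b |N − M_exact|·|f_n'| ≤ n (A_q + 12.975 (log(a+4) + 1))/a`, `A_q = 5.014 + 12.975 log(9.1902 q)`. -/
theorem integral_remainder_le (hχ : χ.IsPrimitive) (hq : 1 < q) (n : ℕ) {a b : ℝ} (ha : 0 < a) (hab : a ≤ b) :
    ∫ t in a..b, |(lfunctionZeroCount χ t : ℝ) - charCountMainExact χ t| * |liWindowWeightDeriv n t| ≤
      n * (5.014 + 12.975 * Real.log (9.1902 * q) + 12.975 * (Real.log (a + 4) + 1)) / a := by
  have hχ1 : χ ≠ 1 := ne_one_of_isPrimitive hχ hq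
  have hq2 : (2 : ℝ) ≤ q := by exact_mod_cast hq
  have hn : (0 : ℝ) ≤ n := n.cast_nonneg
  set A : ℝ := 5.014 + 12.975 * Real.log (9.1902 * q) with hA
  have hA0 : 0 ≤ A := by
    have : 0 ≤ Real.log (9.1902 * (q : ℝ)) := Real.log_nonneg (by nlinarith)
    rw [hA]; positivity
  have hIcc : uIcc a b = Icc a b := uIcc_of_le hab
  -- the dominating primitive
  set G : ℝ → ℝ := fun t ↦ -((n : ℝ) * (A + 12.975 * (Real.log (t + 4) + 1)) / t) with hG
  set G' : ℝ → ℝ := fun t ↦ (n : ℝ) * (A + 12.975 * (Real.log (t + 4) + 1)) / t ^ 2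
    - (n : ℝ) * 12.975 / (t * (t + 4)) with hG'
  have hderiv : ∀ t ∈ uIcc a b, HasDerivAt G (G' t) t := by
    intro t ht
    rw [hIcc] at ht
    have ht0 : t ≠ 0 := by linarith [ht.1]
    have ht4 : t + 4 ≠ 0 := by linarith [ht.1]
    have h1 : HasDerivAt (fun y : ℝ ↦ (n : ℝ) * (A + 12.975 * (Real.log (y + 4) + 1)))
        ((n : ℝ) * (12.975 * (1 / (t + 4)))) t := by
      have hl : HasDerivAt (fun y : ℝ ↦ Real.log (y + 4)) (1 / (t + 4)) t := by
        have h := ((hasDerivAt_id t).add_const (4 : ℝ)).log (by simpa using ht4)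
        simpa using h
      have h := ((hl.add_const 1).const_mul (12.975 : ℝ)).const_add A
      simpa using h.const_mul (n : ℝ)
    have h := (h1.div (hasDerivAt_id t) ht0).neg
    refine h.congr_deriv ?_
    simp only [id, hG']
    field_simp
    ring
  have hG'cont : ContinuousOn G' (uIcc a b) := by
    refine continuousOn_of_forall_continuousAt fun t ht ↦ ?_
    rw [hIcc] at ht
    have ht0 : t ≠ 0 := by linarith [ht.1]
    have ht4 : t + 4 ≠ 0 := by linarith [ht.1]
    have ht2 : t ^ 2 ≠ 0 := pow_ne_zero 2 ht0
    have ht04 : t * (t + 4) ≠ 0 := mul_ne_zero ht0 ht4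
    simp only [hG']
    fun_prop (disch := assumption)
  have hG'int : IntervalIntegrable G' volume a b := hG'cont.intervalIntegrable
  -- pointwise domination
  have hptw : ∀ t ∈ Icc a b,
      |(lfunctionZeroCount χ t : ℝ) - charCountMainExact χ t| * |liWindowWeightDeriv n t| ≤ G' t := by
    intro t ht
    have ht0 : 0 < t := by linarith [ht.1]
    have hR := CharCount.abs_count_sub_exact_le_argSRem hχ hq ht0
    rw [argSRem_add_eq hq ht0] at hR
    have hF := Window.abs_liWindowWeightDeriv_le n ht0
    have hlog4 : 0 ≤ Real.log (t + 4) := Real.log_nonneg (by linarith)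
    have h1 : |(lfunctionZeroCount χ t : ℝ) - charCountMainExact χ t| * |liWindowWeightDeriv n t| ≤
        (A + 12.975 * Real.log (t + 4)) * (n / t ^ 2) :=
      mul_le_mul (by rw [hA]; linarith) hF (abs_nonneg _) (by positivity)
    have h2 : (A + 12.975 * Real.log (t + 4)) * (n / t ^ 2) ≤ G' t := by
      simp only [hG']
      rw [← sub_nonneg]
      have e : (n : ℝ) * (A + 12.975 * (Real.log (t + 4) + 1)) / t ^ 2 - (n : ℝ) * 12.975 / (t * (t + 4))
          - (A + 12.975 * Real.log (t + 4)) * (n / t ^ 2) = (n : ℝ) * 12.975 * (4 / (t ^ 2 * (t + 4))) := by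
        field_simp
        ring
      rw [e]
      positivity
    exact h1.trans h2
  have hF'c : ContinuousOn (liWindowWeightDeriv n) (uIcc a b) := by
    rw [hIcc]; exact continuousOn_liWindowWeightDeriv n ha
  have hint : IntervalIntegrable
      (fun t ↦ |(lfunctionZeroCount χ t : ℝ) - charCountMainExact χ t| * |liWindowWeightDeriv n t|) volume a b := by
    have h := (CharCount.intervalIntegrable_remainder_mul hχ1 hF'c).abs
    exact h.congr fun t _ ↦ abs_mul _ _
  have hb0 : 0 < b := lt_of_lt_of_le ha hab
  have hGb : G b ≤ 0 := by
    simp only [hG]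
    have : 0 ≤ Real.log (b + 4) := Real.log_nonneg (by linarith)
    have : 0 ≤ (n : ℝ) * (A + 12.975 * (Real.log (b + 4) + 1)) / b := by positivity
    linarith
  calc ∫ t in a..b, |(lfunctionZeroCount χ t : ℝ) - charCountMainExact χ t| * |liWindowWeightDeriv n t|
      ≤ ∫ t in a..b, G' t := intervalIntegral.integral_mono_on hab hint hG'int hptw
    _ = G b - G a := intervalIntegral.integral_eq_sub_of_hasDerivAt hderiv hG'int
    _ ≤ -G a := by linarith
    _ = n * (5.014 + 12.975 * Real.log (9.1902 * q) + 12.975 * (Real.log (a + 4) + 1)) / a := by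
        simp only [hG, hA]; ring

end OscChar

open OscChar

/-- **Stub `stub_osc_plain` of crux `LiOscillatoryChar`** (route `LiDirichletAsymptotic`, stmt-RiemannHypothesis-19628;
RH-FREE · GRH-FREE): for `χ` primitive mod `q > 1`, `n ≥ 10⁴`, `T' ≥ n²`,
`|(charWeightTrace χ n T' − charWeightTrace χ n √n) − (2/π)∫_{√n}^{T'} f_n g_χ| ≤ charErrOscP q n + (n²/(2T'²)) argSRem q T'`.
Verbatim the registered signature `Sig.stub_osc_plain`. -/
theorem liOscillatoryChar_plain :
    ∀ (q : ℕ) [NeZero q] (χ : DirichletCharacter ℂ q), χ.IsPrimitive → 1 < q →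
      ∀ (n : ℕ) (T' : ℝ), (n : ℝ) ^ 2 ≤ T' → 10000 ≤ n →
        |(charWeightTrace χ n T' - charWeightTrace χ n (Real.sqrt n))
            - 2 / Real.pi * (∫ t in Real.sqrt n..T', liWindowWeight n t * charGammaDensity χ t)| ≤
          charErrOscP q n + (n : ℝ) ^ 2 / (2 * T' ^ 2) * argSRem q T' := by
  intro q _ χ hχ hq n T' hT' hn
  have hχ1 : χ ≠ 1 := ne_one_of_isPrimitive hχ hq
  have hq2 : (2 : ℝ) ≤ q := by exact_mod_cast hq
  have hnR : (10000 : ℝ) ≤ n := by exact_mod_cast hn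
  have hn0 : (0 : ℝ) ≤ n := by positivity
  -- sizes
  set a := Real.sqrt n with ha_def
  have ha2 : a ^ 2 = n := Real.sq_sqrt hn0
  have ha100 : 100 ≤ a := by
    rw [ha_def, show (100 : ℝ) = Real.sqrt (100 ^ 2) by rw [Real.sqrt_sq (by norm_num)]]
    exact Real.sqrt_le_sqrt (by linarith)
  have ha0 : 0 < a := by linarith
  have hab : a ≤ T' := by nlinarith
  have hT'0 : 0 < T' := by linarith
  -- the window sum is `∑ m f_n(|γ|)` (`|γ| > a > 0`: the completed weight is `f_n`)
  have hW : charWeightTrace χ n T' - charWeightTrace χ n a =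
      ∑ᶠ ρ ∈ lfunctionZeroBox χ T' \ lfunctionZeroBox χ a, (zeroOrder χ ρ : ℝ) * liWindowWeight n |ρ.im| := by
    rw [CharCount.charWeightTrace_sub hχ1 n hab]
    refine finsum_mem_congr rfl fun ρ hρ ↦ ?_
    have hρa : a < |ρ.im| := (CharCount.mem_window.1 hρ).2
    have hne : |ρ.im| ≠ 0 := by linarith
    simp only [liWindowWeight₀, hne, if_false]
  have hI : 2 / Real.pi * (∫ t in a..T', liWindowWeight n t * charGammaDensity χ t) =
      ∫ t in a..T', liWindowWeight n t * (2 / Real.pi * charGammaDensity χ t) := by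
    rw [← intervalIntegral.integral_const_mul]
    exact intervalIntegral.integral_congr fun t _ ↦ by ring
  have hmain := CharCount.abs_finsum_window_sub_integral_le hχ1 hab (F := liWindowWeight n)
    (F' := liWindowWeightDeriv n) (fun t ht ↦ hasDerivAt_liWindowWeight n (by linarith [ht.1] : t ≠ 0))
    (continuousOn_liWindowWeightDeriv n ha0)
  rw [hW, hI]
  refine hmain.trans ?_
  -- the three pieces
  have hRT := CharCount.abs_count_sub_exact_le_argSRem hχ hq hT'0
  have hRa := CharCount.abs_count_sub_exact_le_argSRem hχ hq ha0
  obtain ⟨hfT0, -⟩ := SmoothReplace.liWindowWeight_mem n T'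
  obtain ⟨hfa0, hfa2⟩ := SmoothReplace.liWindowWeight_mem n a
  have hfT := SmoothReplace.liWindowWeight_le_sq n hT'0
  have hargT : 0 ≤ argSRem q T' + 0.014 := (abs_nonneg _).trans hRT
  have harga : 0 ≤ argSRem q a + 0.014 := (abs_nonneg _).trans hRa
  have htop : |(lfunctionZeroCount χ T' : ℝ) - charCountMainExact χ T'| * |liWindowWeight n T'| ≤
      (argSRem q T' + 0.014) * ((n : ℝ) ^ 2 / (2 * T' ^ 2)) := by
    rw [abs_of_nonneg hfT0]
    exact mul_le_mul hRT hfT hfT0 hargT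
  have hbot : |(lfunctionZeroCount χ a : ℝ) - charCountMainExact χ a| * |liWindowWeight n a| ≤
      (argSRem q a + 0.014) * 2 := by
    rw [abs_of_nonneg hfa0]
    exact mul_le_mul hRa hfa2 hfa0 harga
  have hint := integral_remainder_le hχ hq n ha0 hab
  -- numerics
  have hsmall : (n : ℝ) ^ 2 / (2 * T' ^ 2) ≤ 1 / 2 := by
    rw [div_le_div_iff₀ (by positivity) (by norm_num)]
    nlinarith
  have hlog9 : Real.log (9.1902 * (q : ℝ)) ≤ 2.2194 + Real.log q := by
    rw [Real.log_mul (by norm_num) (by positivity)]; linarith [log_91902_le]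
  have hL0 : 0 ≤ Real.log (q : ℝ) := Real.log_nonneg (by linarith)
  have hla : 0 ≤ Real.log (a + 4) := Real.log_nonneg (by linarith)
  have hint' : (n : ℝ) * (5.014 + 12.975 * Real.log (9.1902 * q) + 12.975 * (Real.log (a + 4) + 1)) / a =
      a * (5.014 + 12.975 * Real.log (9.1902 * q) + 12.975 * (Real.log (a + 4) + 1)) := by
    rw [← ha2]; field_simp
  rw [hint'] at hint
  have hkey : a * (5.014 + 12.975 * Real.log (9.1902 * q) + 12.975 * (Real.log (a + 4) + 1)) ≤
      a * (12.975 * (Real.log q + Real.log (a + 4)) + 46.8) - 0.014 * a := by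
    nlinarith
  unfold charErrOscP
  rw [← ha_def]
  nlinarith [mul_nonneg hargT (by positivity : (0 : ℝ) ≤ (n : ℝ) ^ 2 / (2 * T' ^ 2))]

end Summit.RiemannHypothesis.RiemannHypothesis.Theorems.LiTheory

end
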